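import Literature.NumberTheory.LFunctions.SiegelZeroExceptionalPrimesSecond
import Literature.NumberTheory.LFunctions.MertensFormula
import HarnessLib

/-!
# Matomäki–Merikoski 2023, Lemma 2.2: `λ = 1 ∗ χ` has small mass on rough numbers at a Siegel zero

Sibling of `Literature/Barriers/Parity/SiegelZeroPrimePairs.lean` (the catalogue entry vendoring
Matomäki–Merikoski, *Siegel zeros, twin primes, Goldbach's conjecture, and primes in short
intervals* (IMRN 2023; arXiv:2112.11412), Theorem 1.3 = the named fact
`Literature.Barriers.Parity.MatomakiMerikoski2023_pairCorrelation`, with Corollary 1.1 (i)/(ii) =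
`MatomakiMerikoski2023_fixedShift` / `MatomakiMerikoski2023_fixedShift_ii`, both already reduced to
Theorem 1.3 in `SiegelZeroPrimePairsFixedShift.lean` / `SiegelZeroPrimePairsProofs.lean`).
Everything in this file is PROVED (theorems only). It supplies the second of the five inputs of the
printed proof of Theorem 1.3 (§2 "Initial steps": Lemma 2.1 (Henriot), **Lemma 2.2**,
Proposition 2.3, Lemma 2.4, Lemma 2.5 — the last is `SiegelZeroPrimePairsCharSums.lean`):

* `MatomakiMerikoski2023_lemma22` — **Lemma 2.2**: for a primitive quadratic `χ` mod `q ≥ 2`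
  with a real zero `β₀ = 1 − 1/(η log q)`, `η ≥ 10`, `z = q^v` (`v > 0`) and `Y > z`,
  `∑_{z ≤ m ≤ Y, (m, P(z)) = 1} λ(m)/m ≤ K (1/(v² η^{v/2}) + (v/η) log Y/log z + 1/z)(log Y/log z)²`
  with an absolute `K`, where `λ = 1 ∗ χ` ((2.3); Mathlib's `DirichletCharacter.zetaMul`) and
  `(m, P(z)) = 1` means that all prime factors of `m` are `≥ z`
  ("the sum over `m` can be estimated in terms of `η`": in the illusory world `λ` behaves like the
  indicator of squares on rough numbers, so the bilinear error terms of (2.6) are negligible).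

The tools, in the sub-namespace `MatomakiMerikoski` (as `SiegelZeroPrimePairsCharSumTools.lean`):

* `one_add_sum_rough_le_prod` — `1 + ∑_{1 < m ≤ N, m z-rough} λ(m)/m ≤ Π(z, N)`,
  `Π = ∏_{z ≤ p ≤ N} (1 − 1/p)⁻¹(1 − χ(p)/p)⁻¹` (Euler product over smooth numbers, Mathlib's
  `EulerProduct.summable_and_hasSum_smoothNumbers_prod_primesBelow_tsum`, for the multiplicative
  function `λ(m)/m · 1_{m z-rough}`); `eulerFactor_le_sq`, `eulerFactor_le_exp`,
  `one_le_eulerFactor` — `1 ≤ (1 − 1/p)⁻¹(1 − χ(p)/p)⁻¹ ≤ min((1 − 1/p)⁻², exp(λ(p)/p + 4/p²))`;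
* `exists_window_prod_le` — Mertens in a window, `∏_{z ≤ p ≤ Y}(1 − 1/p)⁻¹ ≤ C log Y/log z`
  ((eq:Mertens), from the tree's `Literature.NumberTheory.LFunctions.Mertens.abs_mertensLog_sub_le`);
* `exists_sum_excPrimes_window_le` — the prime sum of §4 (Lemma 4.1 of the source, "essentially
  [TT]", summed over the cover of `[z, Y]`): `∑_{z ≤ p* ≤ Y} 1/p* ≪ 1/(v²η^{v/2}) + (v/η) log Y/log z`
  over the exceptional primes `p*` (`χ(p*) ≠ −1`), for `η ≥ η₀`, from the tree's PROVED
  Tao–Teräväinen Proposition 3.5, `Literature.NumberTheory.LFunctions.SiegelZero.TaoTeravainen2021_eq313_holds`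
  / `TaoTeravainen2021_eq314_holds` (which contain Siegel's theorem and the Montgomery–Vaughan
  asymptotics quoted in §4).

## What the source prints (§2 and §4 of arXiv:2112.11412, read in the held TeX-derived text)

(2.3): `λ := 1 ∗ χ` and `λ' := χ ∗ log`. Lemma 2.2: "Let `χ` be a primitive quadratic character
modulo `q ≥ 2`. Assume that `L(s, χ)` has a real zero `β₀` such that `β₀ = 1 − 1/(η log q)` for
some `η ≥ 10`. Let `z = q^v` for some `v ∈ ℝ₊`. Then for any `Y > z`
`∑_{z ≤ m ≤ Y, (m, P(z)) = 1} λ(m)/m ≪ (1/(v² η^{v/2}) + (v/η) · log Y/log z + 1/z)(log Y/log z)²`."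
(`P(w) = ∏_{p < w} p`.) Lemma 4.1: "The following lemma is essentially [TT] … Let `δ > 0`. Then,
for any `Y > q^{1/2+δ}`, one has `∑_{q^{1/2+δ} < p ≤ Y} λ(p)/p ≪_δ log Y/(η log q)`, and, for any
`k ≥ 2`, one has `∑_{q^{(1/2+δ)/k} < p ≤ q^{(1/2+δ)/(k−1)}} λ(p)/p ≪_δ k/η^{1/k}`." Proof of
Lemma 2.2 (§4): "First note that we can assume that `1/(v²η^{v/2}) + (v/η) log Y/log z ≤ 1` since
otherwise the claim follows trivially from `λ(m) ≤ τ(m)`, (eq:f(n)/n_average), and (eq:Mertens)";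
split into square-free and non-square-free `m`, the latter `≪ (1/z)(log Y/log z)²`; for the former
`∑ |μ(m)|λ(m)/m ≤ ∏_{z ≤ p ≤ Y}(1 + λ(p)/p) − 1 ≤ exp(∑_{z ≤ p ≤ Y} λ(p)/p) − 1`; "Let `δ > 0` be
small and let `K := ⌈(1/2+δ)/v⌉ … so that `z = q^v ≥ q^{(1/2+δ)/K}`. It is easy to see that either
`K ≤ 2/v` or `K = 1`. Then by Lemma 4.1 `∑_{z ≤ p ≤ Y} λ(p)/p ≤ ∑_{2 ≤ k ≤ K} ∑_{q^{(1/2+δ)/k} < p ≤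
q^{(1/2+δ)/(k−1)}} λ(p)/p + ∑_{q^{1/2+δ} < p ≤ Y} λ(p)/p ≪_δ K² η^{−1/K} + log Y/(η log q) ≪
1/(v² η^{v/2}) + (v/η) log Y/log z`", "and the claim follows."
[cite: MatomakiMerikoski2023, Lemma 2.2, Lemma 4.1, §4]

## Design notes

1. Hypotheses are inlined exactly as in the named facts of `SiegelZeroPrimePairs.lean` (`q ≥ 2`,
   `χ` primitive and `IsQuadratic`, `η ≥ 10`, `L(1 − 1/(η log q), χ) = 0`); `z = q^v` is a
   hypothesis `z = (q : ℝ) ^ v`; the range `z ≤ m ≤ Y` is `Finset.Icc ⌈z⌉₊ ⌊Y⌋₊`, the condition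
   `(m, P(z)) = 1` is the filter `∀ p ∈ m.primeFactors, z ≤ p`; `λ(m)` is `(χ.zetaMul m).re`
   (`χ.zetaMul` is real for quadratic `χ`, `Literature.NumberTheory.LFunctions.ZetaMul.zetaMul_im_eq_zero`).
   The constant `K` is absolute but ineffective (Siegel), as the source's `≪`.
2. Deviations from the printed proof, same result: the square-free/non-square-free split is
   replaced by the full Euler product `Π − 1 ≤ exp(∑ λ(p)/p + 8/z) − 1` (the prime-power terms
   cost `4/p²` in the exponent, summing to `≤ 8/z`); `K := ⌊(3/4)/v⌋ + 1` (`δ = 1/4`) instead of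
   `⌈(1/2+δ)/v⌉`, so that `z > q^{(3/4)/K}` strictly and the half-open ranges of Tao–Teräväinen's
   (3.14) cover `[z, q^{3/4}]`; bounded `η < η₀` (where the tree's form of Proposition 3.5 does not
   apply) is absorbed into the trivial bound, exactly as the source's "we may assume that `η` is
   large since otherwise the claims are trivial" (§4, proof of Lemma 4.1).

## References

* K. Matomäki, J. Merikoski, *Siegel zeros, twin primes, Goldbach's conjecture, and primes in
  short intervals*, IMRN 2023:23, 20337–20384 (arXiv:2112.11412): (2.3), Lemma 2.2 (§2), §3.1
  ((eq:f(n)/n_average), (eq:Mertens)), Lemma 4.1 and §4 (proofs of Lemmas 4.1 and 2.2).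
  [cite: MatomakiMerikoski2023, Lemma 2.2]
* T. Tao, J. Teräväinen, *The Hardy–Littlewood–Chowla conjecture in the presence of a Siegel
  zero*, J. London Math. Soc. (2) 106 (2022), 3317–3378 (arXiv:2109.06291), Proposition 3.5
  ((3.13), (3.14)). [cite: TaoTeravainen2021, Proposition 3.5]
* G. H. Hardy, E. M. Wright, *An Introduction to the Theory of Numbers*, 6th ed., Thm 429
  (Mertens' product theorem). [cite: HardyWright2008, Thm 429 (§22.8)]
-/

noncomputable section

open Finset Real
open Literature.NumberTheory.LFunctions

namespace Literature.Barriers.Parity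

namespace MatomakiMerikoski

variable {q : ℕ} (χ : DirichletCharacter ℂ q)

/-! ### `λ = 1 ∗ χ` at primes and the local Euler factors -/

/-- `λ(p) = 1 + χ(p)` at a prime `p` (`χ` quadratic, real parts). [folklore] -/
theorem zetaMul_prime_re (hχ : χ ^ 2 = 1) {p : ℕ} (hp : p.Prime) :
    (χ.zetaMul p).re = 1 + (χ p).re := by
  have h := SmoothEulerProduct.zetaMul_prime_pow_re χ hχ hp 1
  rw [pow_one] at h
  rw [h, sum_range_succ, sum_range_one, pow_zero, pow_one]

/-- `(1 − x)⁻¹ ≤ exp(x + 2x²)` for `|x| ≤ 1/2` (from `log y ≤ y − 1` at `y = (1 − x)⁻¹`).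
[folklore] -/
theorem inv_one_sub_le_exp {x : ℝ} (hx : |x| ≤ 1 / 2) :
    (1 - x)⁻¹ ≤ Real.exp (x + 2 * x ^ 2) := by
  have hx' := abs_le.mp hx
  have h1 : 0 < 1 - x := by linarith
  have h1' : 0 < (1 - x)⁻¹ := inv_pos.mpr h1
  rw [← Real.exp_log h1', Real.exp_le_exp]
  have h2 : Real.log (1 - x)⁻¹ ≤ (1 - x)⁻¹ - 1 := Real.log_le_sub_one_of_pos h1'
  have h3 : (1 - x)⁻¹ - 1 = x / (1 - x) := by
    field_simp
    ring
  have h4 : x / (1 - x) ≤ x + 2 * x ^ 2 := by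
    rw [div_le_iff₀ h1]
    nlinarith [mul_nonneg (sq_nonneg x) (by linarith : (0 : ℝ) ≤ 1 - 2 * x)]
  linarith

/-- The Euler factor of `∑ λ(n)/n` at `p` is at most `exp(λ(p)/p + 4/p²)`:
`(1 − 1/p)⁻¹ (1 − χ(p)/p)⁻¹ ≤ exp((1 + χ(p))/p + 4/p²)`. [folklore] -/
theorem eulerFactor_le_exp (hχ : χ ^ 2 = 1) {p : ℕ} (hp : p.Prime) :
    (1 - (p : ℝ)⁻¹)⁻¹ * (1 - (χ p).re * (p : ℝ)⁻¹)⁻¹ ≤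
      Real.exp ((χ.zetaMul p).re / p + 4 / (p : ℝ) ^ 2) := by
  have hp2 : (2 : ℝ) ≤ p := by exact_mod_cast hp.two_le
  have hp0 : (0 : ℝ) < p := by linarith
  have hpinv0 : 0 < (p : ℝ)⁻¹ := inv_pos.mpr hp0
  have hpinv : (p : ℝ)⁻¹ ≤ 1 / 2 := by
    rw [inv_eq_one_div]
    exact one_div_le_one_div_of_le two_pos hp2
  have hre : |(χ p).re| ≤ 1 := SmoothEulerProduct.abs_apply_re_le_one χ p
  have hre' := abs_le.mp hre
  have h1 : (1 - (p : ℝ)⁻¹)⁻¹ ≤ Real.exp ((p : ℝ)⁻¹ + 2 * ((p : ℝ)⁻¹) ^ 2) :=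
    inv_one_sub_le_exp (by rw [abs_of_pos hpinv0]; exact hpinv)
  have hcx : |(χ p).re * (p : ℝ)⁻¹| ≤ 1 / 2 := by
    rw [abs_mul, abs_of_pos hpinv0]
    calc |(χ p).re| * (p : ℝ)⁻¹ ≤ 1 * (p : ℝ)⁻¹ := mul_le_mul_of_nonneg_right hre hpinv0.le
      _ ≤ 1 / 2 := by rw [one_mul]; exact hpinv
  have h2 : (1 - (χ p).re * (p : ℝ)⁻¹)⁻¹ ≤
      Real.exp ((χ p).re * (p : ℝ)⁻¹ + 2 * ((χ p).re * (p : ℝ)⁻¹) ^ 2) :=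
    inv_one_sub_le_exp hcx
  have h2nonneg : 0 ≤ (1 - (χ p).re * (p : ℝ)⁻¹)⁻¹ := by
    refine inv_nonneg.mpr ?_
    have := (abs_le.mp hcx).2
    linarith
  calc (1 - (p : ℝ)⁻¹)⁻¹ * (1 - (χ p).re * (p : ℝ)⁻¹)⁻¹
      ≤ Real.exp ((p : ℝ)⁻¹ + 2 * ((p : ℝ)⁻¹) ^ 2) *
          Real.exp ((χ p).re * (p : ℝ)⁻¹ + 2 * ((χ p).re * (p : ℝ)⁻¹) ^ 2) :=
        mul_le_mul h1 h2 h2nonneg (Real.exp_pos _).le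
    _ = Real.exp ((p : ℝ)⁻¹ + 2 * ((p : ℝ)⁻¹) ^ 2 +
          ((χ p).re * (p : ℝ)⁻¹ + 2 * ((χ p).re * (p : ℝ)⁻¹) ^ 2)) := (Real.exp_add _ _).symm
    _ ≤ Real.exp ((χ.zetaMul p).re / p + 4 / (p : ℝ) ^ 2) := by
        rw [Real.exp_le_exp, zetaMul_prime_re χ hχ hp]
        have hre2 : (χ p).re ^ 2 ≤ 1 := by nlinarith
        have h3 : ((χ p).re * (p : ℝ)⁻¹) ^ 2 ≤ ((p : ℝ)⁻¹) ^ 2 := by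
          rw [mul_pow]
          nlinarith [sq_nonneg ((p : ℝ)⁻¹)]
        have heq : (1 + (χ p).re) / p + 4 / (p : ℝ) ^ 2 =
            (p : ℝ)⁻¹ + 2 * ((p : ℝ)⁻¹) ^ 2 + ((χ p).re * (p : ℝ)⁻¹ + 2 * ((p : ℝ)⁻¹) ^ 2) := by
          field_simp
          ring
        rw [heq]
        linarith

/-- The trivial bound for the Euler factor: `(1 − 1/p)⁻¹ (1 − χ(p)/p)⁻¹ ≤ (1 − 1/p)⁻²`.
[folklore] -/
theorem eulerFactor_le_sq {p : ℕ} (hp : p.Prime) :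
    (1 - (p : ℝ)⁻¹)⁻¹ * (1 - (χ p).re * (p : ℝ)⁻¹)⁻¹ ≤ ((1 - (p : ℝ)⁻¹)⁻¹) ^ 2 := by
  have hp2 : (2 : ℝ) ≤ p := by exact_mod_cast hp.two_le
  have hp0 : (0 : ℝ) < p := by linarith
  have hpinv0 : 0 < (p : ℝ)⁻¹ := inv_pos.mpr hp0
  have hpinv : (p : ℝ)⁻¹ ≤ 1 / 2 := by
    rw [inv_eq_one_div]
    exact one_div_le_one_div_of_le two_pos hp2
  have hre : (χ p).re ≤ 1 := (le_abs_self _).trans (SmoothEulerProduct.abs_apply_re_le_one χ p)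
  have ha : 0 < 1 - (p : ℝ)⁻¹ := by linarith
  have hb : 1 - (p : ℝ)⁻¹ ≤ 1 - (χ p).re * (p : ℝ)⁻¹ := by nlinarith
  rw [sq]
  exact mul_le_mul_of_nonneg_left (inv_anti₀ ha hb) (inv_pos.mpr ha).le

/-- The Euler factor is `≥ 1`. [folklore] -/
theorem one_le_eulerFactor {p : ℕ} (hp : p.Prime) :
    1 ≤ (1 - (p : ℝ)⁻¹)⁻¹ * (1 - (χ p).re * (p : ℝ)⁻¹)⁻¹ := by
  have hp2 : (2 : ℝ) ≤ p := by exact_mod_cast hp.two_le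
  have hp0 : (0 : ℝ) < p := by linarith
  have hpinv0 : 0 < (p : ℝ)⁻¹ := inv_pos.mpr hp0
  have hpinv : (p : ℝ)⁻¹ ≤ 1 / 2 := by
    rw [inv_eq_one_div]
    exact one_div_le_one_div_of_le two_pos hp2
  have hre : |(χ p).re| ≤ 1 := SmoothEulerProduct.abs_apply_re_le_one χ p
  have hre' := abs_le.mp hre
  -- `(1 − 1/p)⁻¹ (1 − χ(p)/p)⁻¹ = ((1 − 1/p)(1 − χ(p)/p))⁻¹` and the product is `≤ 1`
  have hprod_pos : 0 < (1 - (p : ℝ)⁻¹) * (1 - (χ p).re * (p : ℝ)⁻¹) := by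
    refine mul_pos (by linarith) ?_
    have : (χ p).re * (p : ℝ)⁻¹ ≤ 1 * (p : ℝ)⁻¹ := mul_le_mul_of_nonneg_right hre'.2 hpinv0.le
    linarith
  have hprod_le : (1 - (p : ℝ)⁻¹) * (1 - (χ p).re * (p : ℝ)⁻¹) ≤ 1 := by
    -- `= 1 − (1 + χ(p))/p + χ(p)/p² ≤ 1 − (1 + χ(p))/p + (1 + χ(p))/(2p) ≤ 1`
    have h1 : 0 ≤ 1 + (χ p).re := by linarith [hre'.1]
    nlinarith [mul_nonneg h1 hpinv0.le, mul_nonneg (mul_nonneg h1 hpinv0.le) hpinv0.le]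
  rw [← mul_inv]
  exact one_le_inv_iff₀.mpr ⟨hprod_pos, hprod_le⟩

/-! ### The Euler product bound over rough numbers -/

/-- **`∑ λ(m)/m` over `z`-rough `m ≤ N` is at most the Euler product over the primes `z ≤ p ≤ N`.**
For quadratic `χ`, real `z` and `1 ≤ N < M`:
`1 + ∑_{1 < m ≤ N, p ∣ m ⇒ p ≥ z} λ(m)/m ≤ ∏_{p < M, p ≥ z} (1 − 1/p)⁻¹ (1 − χ(p)/p)⁻¹`
(the `1` is the term `m = 1`; every `m ≤ N` is `M`-smooth, all terms are `≥ 0`, and the sum of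
the multiplicative function `λ(m)/m · 1_{m z-rough}` over the `M`-smooth numbers is the displayed
product, by Mathlib's `EulerProduct.summable_and_hasSum_smoothNumbers_prod_primesBelow_tsum`).
[folklore] -/
theorem one_add_sum_rough_le_prod (hχ : χ ^ 2 = 1) (z : ℝ) {N M : ℕ} (hN : 1 ≤ N) (hNM : N < M) :
    1 + ∑ m ∈ (Ioc 1 N).filter (fun m => ∀ p ∈ m.primeFactors, z ≤ ((p : ℕ) : ℝ)),
        (χ.zetaMul m).re / m ≤
      ∏ p ∈ M.primesBelow.filter (fun p : ℕ => z ≤ (p : ℝ)),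
        (1 - (p : ℝ)⁻¹)⁻¹ * (1 - (χ p).re * (p : ℝ)⁻¹)⁻¹ := by
  classical
  -- the multiplicative function `f = (λ/id) · 1_{z-rough}`
  set f : ℕ → ℝ := fun n =>
    if ∀ p ∈ n.primeFactors, z ≤ ((p : ℕ) : ℝ) then (χ.zetaMul n).re * (n : ℝ)⁻¹ else 0 with hf
  have hlam0 : ∀ n : ℕ, 0 ≤ (χ.zetaMul n).re * (n : ℝ)⁻¹ := fun n =>
    mul_nonneg (SmoothEulerProduct.zetaMul_re_nonneg χ hχ n) (inv_nonneg.mpr (Nat.cast_nonneg n))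
  have hf0 : ∀ n, 0 ≤ f n := fun n => by
    by_cases h : ∀ p ∈ n.primeFactors, z ≤ ((p : ℕ) : ℝ)
    · simp only [hf, if_pos h]; exact hlam0 n
    · simp only [hf, if_neg h]; exact le_rfl
  have hfle : ∀ n, f n ≤ (χ.zetaMul n).re * (n : ℝ)⁻¹ := fun n => by
    by_cases h : ∀ p ∈ n.primeFactors, z ≤ ((p : ℕ) : ℝ)
    · simp only [hf, if_pos h]; exact le_rfl
    · simp only [hf, if_neg h]; exact hlam0 n
  have hf1 : f 1 = 1 := by
    have h : ∀ p ∈ (1 : ℕ).primeFactors, z ≤ ((p : ℕ) : ℝ) := by simp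
    simp only [hf, if_pos h, SmoothEulerProduct.zetaMul_one_re, Nat.cast_one, inv_one, mul_one]
  have hfzero : f 0 = 0 := by
    have h : ∀ p ∈ (0 : ℕ).primeFactors, z ≤ ((p : ℕ) : ℝ) := by simp
    simp only [hf, if_pos h, Nat.cast_zero, inv_zero, mul_zero]
  have hmul : ∀ {m n : ℕ}, m.Coprime n → f (m * n) = f m * f n := by
    intro m n hmn
    rcases Nat.eq_zero_or_pos m with rfl | hm
    · rw [zero_mul, hfzero, zero_mul]
    rcases Nat.eq_zero_or_pos n with rfl | hn
    · rw [mul_zero, hfzero, mul_zero]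
    have hpf : (m * n).primeFactors = m.primeFactors ∪ n.primeFactors :=
      Nat.primeFactors_mul hm.ne' hn.ne'
    by_cases hcm : ∀ p ∈ m.primeFactors, z ≤ ((p : ℕ) : ℝ)
    · by_cases hcn : ∀ p ∈ n.primeFactors, z ≤ ((p : ℕ) : ℝ)
      · have hcmn : ∀ p ∈ (m * n).primeFactors, z ≤ ((p : ℕ) : ℝ) := by
          intro p hp
          rw [hpf, mem_union] at hp
          exact hp.elim (hcm p) (hcn p)
        simp only [hf, if_pos hcm, if_pos hcn, if_pos hcmn]
        rw [SmoothEulerProduct.zetaMul_re_mul χ hχ hmn, Nat.cast_mul, mul_inv]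
        ring
      · have hcmn : ¬ ∀ p ∈ (m * n).primeFactors, z ≤ ((p : ℕ) : ℝ) := fun h =>
          hcn fun p hp => h p (by rw [hpf, mem_union]; exact Or.inr hp)
        simp only [hf, if_neg hcn, if_neg hcmn, mul_zero]
    · have hcmn : ¬ ∀ p ∈ (m * n).primeFactors, z ≤ ((p : ℕ) : ℝ) := fun h =>
        hcm fun p hp => h p (by rw [hpf, mem_union]; exact Or.inl hp)
      simp only [hf, if_neg hcm, if_neg hcmn, zero_mul]
  -- values at prime powers
  have hpow_of_le : ∀ {p : ℕ}, p.Prime → z ≤ (p : ℝ) → ∀ k : ℕ,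
      f (p ^ k) = (χ.zetaMul (p ^ k)).re * ((p ^ k : ℕ) : ℝ)⁻¹ := by
    intro p hp hzp k
    have hc : ∀ r ∈ (p ^ k).primeFactors, z ≤ ((r : ℕ) : ℝ) := by
      intro r hr
      rcases Nat.eq_zero_or_pos k with rfl | hk
      · simp at hr
      · rw [Nat.primeFactors_prime_pow hk.ne' hp, mem_singleton] at hr
        rw [hr]
        exact hzp
    simp only [hf, if_pos hc]
  have hpow_of_lt : ∀ {p : ℕ}, p.Prime → ¬ z ≤ (p : ℝ) → ∀ k : ℕ, k ≠ 0 → f (p ^ k) = 0 := by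
    intro p hp hzp k hk
    have hc : ¬ ∀ r ∈ (p ^ k).primeFactors, z ≤ ((r : ℕ) : ℝ) := fun h =>
      hzp (h p (by rw [Nat.primeFactors_prime_pow hk hp]; exact mem_singleton_self p))
    simp only [hf, if_neg hc]
  -- summability of the prime-power series
  have hsum : ∀ {p : ℕ}, p.Prime → Summable (fun n : ℕ => ‖f (p ^ n)‖) := by
    intro p hp
    have h := SmoothEulerProduct.hasSum_zetaMul_prime_pow χ hχ hp one_pos
    simp only [Real.rpow_neg_one] at h
    refine Summable.of_nonneg_of_le (fun n => norm_nonneg _) (fun n => ?_) h.summable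
    rw [Real.norm_eq_abs, abs_of_nonneg (hf0 _)]
    exact hfle _
  have hprod :=
    (EulerProduct.summable_and_hasSum_smoothNumbers_prod_primesBelow_tsum hf1 hmul hsum M).2
  -- the local factors
  have hfac : ∀ p ∈ M.primesBelow, ∑' n : ℕ, f (p ^ n) =
      if z ≤ (p : ℝ) then (1 - (p : ℝ)⁻¹)⁻¹ * (1 - (χ p).re * (p : ℝ)⁻¹)⁻¹ else 1 := by
    intro p hp
    have hp' := Nat.prime_of_mem_primesBelow hp
    split_ifs with hzp
    · have h := SmoothEulerProduct.hasSum_zetaMul_prime_pow χ hχ hp' one_pos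
      simp only [Real.rpow_neg_one] at h
      rw [show (fun n : ℕ => f (p ^ n)) =
          fun n => (χ.zetaMul (p ^ n)).re * ((p ^ n : ℕ) : ℝ)⁻¹ from
        funext fun n => hpow_of_le hp' hzp n]
      exact h.tsum_eq
    · rw [tsum_eq_single 0 (fun n hn => hpow_of_lt hp' hzp n hn), pow_zero, hf1]
  rw [prod_congr rfl hfac, ← prod_filter] at hprod
  -- the finite sum inside the sum over smooth numbers
  have hmem : ∀ n ∈ Icc 1 N, n ∈ M.smoothNumbers := fun n hn =>
    Nat.mem_smoothNumbers_of_lt (mem_Icc.mp hn).1 (lt_of_le_of_lt (mem_Icc.mp hn).2 hNM)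
  set T : Finset M.smoothNumbers := (Icc 1 N).attach.map
    ⟨fun n => ⟨n.1, hmem n.1 n.2⟩, fun a b hab => Subtype.ext (by
      have := congrArg Subtype.val hab; exact this)⟩ with hT
  have hle := sum_le_hasSum T (fun m _ => hf0 m) hprod
  have hTsum : ∑ m ∈ T, f (m : ℕ) = ∑ n ∈ Icc 1 N, f n := by
    rw [hT, sum_map, ← sum_attach (Icc 1 N)]
    rfl
  -- `∑_{n ∈ Icc 1 N} f n = f 1 + ∑_{1 < n ≤ N, rough} λ(n)/n`
  have hsplit : ∑ n ∈ Icc 1 N, f n =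
      1 + ∑ m ∈ (Ioc 1 N).filter (fun m => ∀ p ∈ m.primeFactors, z ≤ ((p : ℕ) : ℝ)),
        (χ.zetaMul m).re / m := by
    rw [Icc_eq_cons_Ioc hN, sum_cons, hf1, sum_filter]
    congr 1
  calc 1 + ∑ m ∈ (Ioc 1 N).filter (fun m => ∀ p ∈ m.primeFactors, z ≤ ((p : ℕ) : ℝ)),
        (χ.zetaMul m).re / m = ∑ m ∈ T, f (m : ℕ) := by rw [hTsum, hsplit]
    _ ≤ _ := hle

/-- `∑_{z ≤ p < M, p prime} 4/p² ≤ 8/z` for `z > 1` (Mathlib's `∑_{k < i < n} 1/i² ≤ 2/(k+1)`).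
[folklore] -/
theorem sum_window_div_sq_le {z : ℝ} (hz : 1 < z) (M : ℕ) :
    ∑ p ∈ M.primesBelow.filter (fun p : ℕ => z ≤ (p : ℝ)), 4 / (p : ℝ) ^ 2 ≤ 8 / z := by
  have hz0 : 0 < z := by linarith
  set k : ℕ := ⌈z⌉₊ - 1 with hk
  have hceil : 2 ≤ ⌈z⌉₊ := Nat.lt_ceil.mpr (by exact_mod_cast hz)
  have hk1 : ((k : ℝ) + 1) = ⌈z⌉₊ := by
    rw [hk, Nat.cast_sub (by omega), Nat.cast_one]
    ring
  have hsub : M.primesBelow.filter (fun p : ℕ => z ≤ (p : ℝ)) ⊆ Ioo k M := by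
    intro p hp
    rw [mem_filter, Nat.mem_primesBelow] at hp
    rw [mem_Ioo]
    refine ⟨?_, hp.1.1⟩
    have : ⌈z⌉₊ ≤ p := Nat.ceil_le.mpr hp.2
    omega
  calc ∑ p ∈ M.primesBelow.filter (fun p : ℕ => z ≤ (p : ℝ)), 4 / (p : ℝ) ^ 2
      ≤ ∑ p ∈ Ioo k M, 4 / (p : ℝ) ^ 2 :=
        sum_le_sum_of_subset_of_nonneg hsub fun p _ _ => by positivity
    _ = 4 * ∑ p ∈ Ioo k M, ((p : ℝ) ^ 2)⁻¹ := by
        rw [mul_sum]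
        refine sum_congr rfl fun p _ => ?_
        rw [div_eq_mul_inv]
    _ ≤ 4 * (2 / ((k : ℝ) + 1)) :=
        mul_le_mul_of_nonneg_left (sum_Ioo_inv_sq_le k M) (by norm_num)
    _ = 8 / (⌈z⌉₊ : ℝ) := by rw [hk1]; ring
    _ ≤ 8 / z := div_le_div_of_nonneg_left (by norm_num) hz0 (Nat.le_ceil z)

/-! ### Mertens in a window: `∏_{z ≤ p ≤ Y} (1 − 1/p)⁻¹ ≪ log Y / log z` -/

/-- **Mertens' product theorem in a window** ((eq:Mertens) of the source, `k = 1`, upper half):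
there is an absolute `C ≥ 1` with `∏_{z ≤ p ≤ Y} (1 − 1/p)⁻¹ ≤ C · log Y / log z` for all real
`1 < z ≤ Y` (from the tree's `|∑_{p ≤ x} −log(1 − 1/p) − log log x − γ| ≤ 12/log x`,
`Literature.NumberTheory.LFunctions.Mertens.abs_mertensLog_sub_le`).
[cite: MatomakiMerikoski2023, §3.1 (eq:Mertens)] -/
theorem exists_window_prod_le :
    ∃ C : ℝ, 1 ≤ C ∧ ∀ z Y : ℝ, 1 < z → z ≤ Y →
      ∏ p ∈ (⌊Y⌋₊ + 1).primesBelow.filter (fun p : ℕ => z ≤ (p : ℝ)), (1 - (p : ℝ)⁻¹)⁻¹ ≤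
        C * (Real.log Y / Real.log z) := by
  have hlog2 : 0 < Real.log 2 := Real.log_pos one_lt_two
  have hlog2' : Real.log 2 < 1 := by
    have := Real.log_two_lt_d9
    linarith
  set C : ℝ := 2 * Real.exp (1 + 24 / Real.log 2) with hC
  have hC1 : 1 ≤ Real.exp (1 + 24 / Real.log 2) := Real.one_le_exp (by positivity)
  have hC24 : Real.exp (24 / Real.log 2) ≤ Real.exp (1 + 24 / Real.log 2) :=
    Real.exp_le_exp.mpr (by linarith)
  refine ⟨C, by rw [hC]; linarith, ?_⟩
  intro z Y hz hzY
  have hz0 : 0 < z := by linarith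
  have hY1 : 1 < Y := by linarith
  have hlogz : 0 < Real.log z := Real.log_pos hz
  have hlogY : 0 < Real.log Y := Real.log_pos hY1
  have hlogzY : Real.log z ≤ Real.log Y := Real.log_le_log hz0 hzY
  have ht1 : 1 ≤ Real.log Y / Real.log z := by rwa [le_div_iff₀ hlogz, one_mul]
  have hprimesLE : (⌊Y⌋₊ + 1).primesBelow = Nat.primesLE ⌊Y⌋₊ := rfl
  rw [hprimesLE]
  have hfull : ∏ p ∈ Nat.primesLE ⌊Y⌋₊, (1 - (p : ℝ)⁻¹)⁻¹ = Real.exp (Nicolas.mertensLog Y) := by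
    rw [Nicolas.mertensLog_eq_natCast_floor, Nicolas.exp_mertensLog_natCast]
  have hγ : Real.eulerMascheroniConstant ≤ 1 := by
    linarith [Real.eulerMascheroniConstant_lt_two_thirds]
  rcases le_or_gt z 2 with hz2 | hz2
  · -- `z ≤ 2`: the window consists of all primes `≤ Y`
    have hfilter : (Nat.primesLE ⌊Y⌋₊).filter (fun p : ℕ => z ≤ (p : ℝ)) = Nat.primesLE ⌊Y⌋₊ := by
      refine filter_true_of_mem fun p hp => ?_
      have h2p : (2 : ℝ) ≤ p := by exact_mod_cast (Nat.mem_primesLE.mp hp).2.two_le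
      linarith
    rw [hfilter, hfull]
    have hlogz1 : Real.log z ≤ 1 := (Real.log_le_log hz0 hz2).trans hlog2'.le
    have hYt : Real.log Y ≤ Real.log Y / Real.log z := by
      rw [le_div_iff₀ hlogz]
      exact mul_le_of_le_one_right hlogY.le hlogz1
    rcases lt_or_ge Y 2 with hY2 | hY2
    · -- `Y < 2`: no primes at all
      have hfl : ⌊Y⌋₊ = 1 := by
        rw [Nat.floor_eq_iff (by linarith)]
        constructor <;> norm_num <;> linarith
      have h0 : Nicolas.mertensLog Y = 0 := by
        rw [Nicolas.mertensLog_eq_natCast_floor, hfl, Nicolas.mertensLog_natCast,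
          Nat.primesLE_one, sum_empty]
      rw [h0, Real.exp_zero]
      calc (1 : ℝ) ≤ C := by rw [hC]; linarith
        _ ≤ C * (Real.log Y / Real.log z) := le_mul_of_one_le_right (by rw [hC]; positivity) ht1
    · have hM := (abs_le.mp (Mertens.abs_mertensLog_sub_le hY2)).2
      have h12 : 12 / Real.log Y ≤ 12 / Real.log 2 :=
        div_le_div_of_nonneg_left (by norm_num) hlog2 (Real.log_le_log two_pos hY2)
      have h12' : 12 / Real.log 2 ≤ 24 / Real.log 2 :=
        div_le_div_of_nonneg_right (by norm_num) hlog2.le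
      have hmL : Nicolas.mertensLog Y ≤ Real.log (Real.log Y) + (1 + 24 / Real.log 2) := by
        linarith
      calc Real.exp (Nicolas.mertensLog Y)
          ≤ Real.exp (Real.log (Real.log Y) + (1 + 24 / Real.log 2)) := Real.exp_le_exp.mpr hmL
        _ = Real.log Y * Real.exp (1 + 24 / Real.log 2) := by
            rw [Real.exp_add, Real.exp_log hlogY]
        _ ≤ (Real.log Y / Real.log z) * Real.exp (1 + 24 / Real.log 2) :=
            mul_le_mul_of_nonneg_right hYt (Real.exp_pos _).le
        _ ≤ C * (Real.log Y / Real.log z) := by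
            rw [hC]
            nlinarith [Real.exp_pos (1 + 24 / Real.log 2)]
  · -- `z > 2`: the window is `primesLE ⌊Y⌋ \ primesLE x`, `x = ⌈z⌉ − 1 ≥ 2`
    set x : ℕ := ⌈z⌉₊ - 1 with hx
    have hceil3 : 3 ≤ ⌈z⌉₊ := Nat.lt_ceil.mpr (by exact_mod_cast hz2)
    have hx2 : 2 ≤ x := by omega
    have hxR : (x : ℝ) = ⌈z⌉₊ - 1 := by rw [hx, Nat.cast_sub (by omega), Nat.cast_one]
    have hxz : (x : ℝ) < z := by rw [hxR]; linarith [Nat.ceil_lt_add_one hz0.le]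
    have hxz' : z ≤ (x : ℝ) + 1 := by rw [hxR]; linarith [Nat.le_ceil z]
    have hx0 : (0 : ℝ) < x := by exact_mod_cast (show 0 < x by omega)
    have hxY : x ≤ ⌊Y⌋₊ := Nat.le_floor (by linarith)
    have hsub : Nat.primesLE x ⊆ Nat.primesLE ⌊Y⌋₊ := fun p hp => by
      rw [Nat.mem_primesLE] at hp ⊢
      exact ⟨hp.1.trans hxY, hp.2⟩
    have hfilter : (Nat.primesLE ⌊Y⌋₊).filter (fun p : ℕ => z ≤ (p : ℝ)) =
        Nat.primesLE ⌊Y⌋₊ \ Nat.primesLE x := by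
      ext p
      simp only [mem_filter, mem_sdiff, Nat.mem_primesLE]
      constructor
      · rintro ⟨⟨hpY, hpp⟩, hzp⟩
        refine ⟨⟨hpY, hpp⟩, fun ⟨hpx, _⟩ => ?_⟩
        have : (p : ℝ) ≤ x := by exact_mod_cast hpx
        linarith
      · rintro ⟨⟨hpY, hpp⟩, hnot⟩
        refine ⟨⟨hpY, hpp⟩, ?_⟩
        have hpx : ¬ p ≤ x := fun h => hnot ⟨h, hpp⟩
        have : (x : ℝ) + 1 ≤ p := by exact_mod_cast Nat.lt_of_not_le hpx
        linarith
    have hfac_pos : ∀ p ∈ Nat.primesLE ⌊Y⌋₊, 0 < (1 - (p : ℝ)⁻¹)⁻¹ := fun p hp => by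
      have h2p : (2 : ℝ) ≤ p := by exact_mod_cast (Nat.mem_primesLE.mp hp).2.two_le
      have : (p : ℝ)⁻¹ ≤ 1 / 2 := by
        rw [inv_eq_one_div]; exact one_div_le_one_div_of_le two_pos h2p
      exact inv_pos.mpr (by linarith)
    have hprod_x : ∏ p ∈ Nat.primesLE x, (1 - (p : ℝ)⁻¹)⁻¹ = Real.exp (Nicolas.mertensLog x) :=
      (Nicolas.exp_mertensLog_natCast x).symm
    have hwindow : ∏ p ∈ (Nat.primesLE ⌊Y⌋₊).filter (fun p : ℕ => z ≤ (p : ℝ)), (1 - (p : ℝ)⁻¹)⁻¹ =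
        Real.exp (Nicolas.mertensLog Y - Nicolas.mertensLog x) := by
      rw [hfilter, Real.exp_sub, ← hfull, ← hprod_x,
        eq_div_iff (prod_pos fun p hp => hfac_pos p (hsub hp)).ne', prod_sdiff hsub]
    rw [hwindow]
    -- Mertens at both ends
    have hY2 : (2 : ℝ) ≤ Y := by linarith
    have hx2R : (2 : ℝ) ≤ x := by exact_mod_cast hx2
    have hMY := (abs_le.mp (Mertens.abs_mertensLog_sub_le hY2)).2
    have hMx := (abs_le.mp (Mertens.abs_mertensLog_sub_le hx2R)).1
    have hlogx : 0 < Real.log x := Real.log_pos (by linarith)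
    have hlogx2 : Real.log 2 ≤ Real.log x := Real.log_le_log two_pos hx2R
    have hlogY2 : Real.log 2 ≤ Real.log Y := Real.log_le_log two_pos hY2
    have h12Y : 12 / Real.log Y ≤ 12 / Real.log 2 :=
      div_le_div_of_nonneg_left (by norm_num) hlog2 hlogY2
    have h12x : 12 / Real.log x ≤ 12 / Real.log 2 :=
      div_le_div_of_nonneg_left (by norm_num) hlog2 hlogx2
    have hdiff : Nicolas.mertensLog Y - Nicolas.mertensLog x ≤
        Real.log (Real.log Y) - Real.log (Real.log x) + 24 / Real.log 2 := by
      have : (24 : ℝ) / Real.log 2 = 12 / Real.log 2 + 12 / Real.log 2 := by ring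
      linarith
    -- `log x ≥ (log z)/2`
    have hlogxz : Real.log z ≤ 2 * Real.log x := by
      rcases le_or_gt z 4 with hz4 | hz4
      · calc Real.log z ≤ Real.log 4 := Real.log_le_log hz0 hz4
          _ = 2 * Real.log 2 := by
              rw [show (4 : ℝ) = 2 ^ 2 by norm_num, Real.log_pow]; norm_num
          _ ≤ 2 * Real.log x := by linarith
      · have h5 : (z - 1) ^ 2 ≤ (x : ℝ) ^ 2 := pow_le_pow_left₀ (by linarith) (by linarith) 2
        have h6 : z ≤ (z - 1) ^ 2 := by nlinarith
        calc Real.log z ≤ Real.log ((x : ℝ) ^ 2) := Real.log_le_log hz0 (h6.trans h5)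
          _ = 2 * Real.log x := by rw [Real.log_pow]; norm_num
    have hratio : Real.log Y / Real.log x ≤ 2 * (Real.log Y / Real.log z) := by
      rw [div_le_iff₀ hlogx, mul_comm 2, mul_assoc, div_mul_eq_mul_div, le_div_iff₀ hlogz]
      nlinarith
    calc Real.exp (Nicolas.mertensLog Y - Nicolas.mertensLog x)
        ≤ Real.exp (Real.log (Real.log Y) - Real.log (Real.log x) + 24 / Real.log 2) :=
          Real.exp_le_exp.mpr hdiff
      _ = Real.log Y / Real.log x * Real.exp (24 / Real.log 2) := by
          rw [Real.exp_add, Real.exp_sub, Real.exp_log hlogY, Real.exp_log hlogx]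
      _ ≤ 2 * (Real.log Y / Real.log z) * Real.exp (1 + 24 / Real.log 2) :=
          mul_le_mul hratio hC24 (Real.exp_pos _).le (by positivity)
      _ = C * (Real.log Y / Real.log z) := by rw [hC]; ring

/-! ### The exceptional primes of a window (Lemma 4.1, from Tao–Teräväinen's Proposition 3.5) -/

open SiegelZero in
/-- **The prime sum behind Lemma 2.2** (the source's Lemma 4.1 = Tao–Teräväinen 2022,
Proposition 3.5, combined over the cover of `[z, Y]` used in §4): there are `C > 0` and `η₀`
such that for every primitive quadratic `χ` mod `q`, every real zero `1 − 1/(η log q)` of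
`L(s, χ)` with `η ≥ η₀`, every `v > 0` and every `Y ≥ z = q^v`, the exceptional primes
`p*` (`χ(p*) ≠ −1`) of `[z, Y]` satisfy
`∑_{z ≤ p* ≤ Y} 1/p* ≤ C (1/(v² η^{v/2}) + (v/η) · log Y/log z)`.
Proof as printed: with `δ = 1/4`, `K = ⌊(3/4)/v⌋ + 1` (so `z > q^{(3/4)/K}` and either `K = 1`
or `K ≤ (3/2)/v`), the primes of `[z, min(Y, q^{3/4})]` are covered by the ranges
`(q^{(3/4)/k}, q^{(3/4)/(k−1)}]`, `2 ≤ k ≤ K`, each contributing `≪ k η^{−1/k} ≤ K η^{−1/K}` by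
(3.14) (`TaoTeravainen2021_eq314_holds`), in total `≪ K² η^{−1/K} ≤ (4/v²) η^{−v/2}`, and the
primes of `(q^{3/4}, Y]` contribute `≪ log Y/(η log q) = (v/η) log Y/log z` by (3.13)
(`TaoTeravainen2021_eq313_holds`).
[cite: MatomakiMerikoski2023, Lemma 4.1 and §4 (proof of Lemma 2.2)] -/
theorem exists_sum_excPrimes_window_le :
    ∃ C η₀ : ℝ, 0 < C ∧ ∀ (q : ℕ) [NeZero q] (χ : DirichletCharacter ℂ q), χ.IsPrimitive →
      χ.IsQuadratic → ∀ η : ℝ, η₀ ≤ η → χ.LFunction ((1 - 1 / (η * Real.log q) : ℝ) : ℂ) = 0 →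
        ∀ v : ℝ, 0 < v → ∀ Y : ℝ, (q : ℝ) ^ v ≤ Y →
          ∑ p ∈ excPrimes χ (Icc ⌈(q : ℝ) ^ v⌉₊ ⌊Y⌋₊), (1 : ℝ) / p ≤
            C * (1 / (v ^ 2 * η ^ (v / 2)) +
              v / η * (Real.log Y / Real.log ((q : ℝ) ^ v))) := by
  obtain ⟨K₁, η₁, H₁⟩ := TaoTeravainen2021_eq313_holds (1 / 2) (by norm_num)
  obtain ⟨K₂, η₂, H₂⟩ := TaoTeravainen2021_eq314_holds (1 / 2) (by norm_num)
  set K₁' : ℝ := max K₁ 0 with hK₁'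
  set K₂' : ℝ := max K₂ 0 with hK₂'
  refine ⟨max (4 * K₂') K₁' + 1, max (max η₁ η₂) 1, by positivity, ?_⟩
  intro q _ χ hprim hquad η hη hL v hv Y hY
  have hη₁ : η₁ ≤ η := (le_max_left _ _).trans ((le_max_left _ _).trans hη)
  have hη₂ : η₂ ≤ η := (le_max_right _ _).trans ((le_max_left _ _).trans hη)
  have hη1 : 1 ≤ η := (le_max_right _ _).trans hη
  have hη0 : 0 < η := by linarith
  -- the conductor and `z = q^v`
  have hq2 : 2 ≤ q := two_le_of_LFunction_eq_zero hL
  have hq1 : (1 : ℝ) < q := by exact_mod_cast hq2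
  have hq0 : (0 : ℝ) < q := by linarith
  have hlogq : 0 < Real.log q := Real.log_pos hq1
  set z : ℝ := (q : ℝ) ^ v with hzdef
  have hz1 : 1 < z := Real.one_lt_rpow hq1 hv
  have hz0 : 0 < z := by linarith
  have hlogz : Real.log z = v * Real.log q := by rw [hzdef, Real.log_rpow hq0]
  have hlogz0 : 0 < Real.log z := by rw [hlogz]; positivity
  have hY1 : 1 < Y := by linarith
  have hY0 : 0 < Y := by linarith
  have hlogY : 0 < Real.log Y := Real.log_pos hY1
  have ht0 : 0 ≤ Real.log Y / Real.log z := by positivity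
  -- the exponents of Tao–Teräväinen with `ε = 1/2`: `(1 + ε)/2 = 3/4 =: a`
  set a : ℝ := 3 / 4 with ha
  have ha0 : 0 < a := by norm_num
  have hexp₁ : (1 + 1 / 2 : ℝ) / 2 = a := by norm_num
  have hexp₂ : ∀ m : ℕ, (1 + 1 / 2 : ℝ) / (2 * m) = a / m := fun m => by
    rw [← div_div, hexp₁]
  have hexp₃ : ∀ m : ℕ, (1 + 1 / 2 : ℝ) / (2 * ((m : ℝ) - 1)) = a / ((m : ℝ) - 1) := fun m => by
    rw [← div_div, hexp₁]
  -- `K = ⌊a/v⌋ + 1`, so that `a/K < v`, i.e. `q^{a/K} < z`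
  set K : ℕ := ⌊a / v⌋₊ + 1 with hKdef
  have hK1 : 1 ≤ K := by omega
  have hK0 : (0 : ℝ) < K := by exact_mod_cast (show 0 < K by omega)
  have haKv : a / K < v := by
    rw [div_lt_iff₀ hK0]
    have h := Nat.lt_floor_add_one (a / v)
    rw [div_lt_iff₀ hv] at h
    calc a < (⌊a / v⌋₊ + 1 : ℝ) * v := by exact_mod_cast h
      _ = v * K := by rw [hKdef]; push_cast; ring
  have hzK : (q : ℝ) ^ (a / K) < z := Real.rpow_lt_rpow_of_exponent_lt hq1 haKv
  -- the cover
  set A : Finset ℕ := excPrimes χ (Ioc ⌊(q : ℝ) ^ a⌋₊ ⌊Y⌋₊) with hA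
  set B : ℕ → Finset ℕ := fun m => excPrimes χ (Ioc ⌊(q : ℝ) ^ (a / m)⌋₊
      ⌊(q : ℝ) ^ (a / ((m : ℝ) - 1))⌋₊) with hB
  have hcover : excPrimes χ (Icc ⌈z⌉₊ ⌊Y⌋₊) ⊆ A ∪ (Icc 2 K).biUnion B := by
    intro p hp
    rw [mem_excPrimes, mem_Icc] at hp
    obtain ⟨⟨hpz, hpY⟩, hpp, hpχ⟩ := hp
    have hpz' : z ≤ p := Nat.ceil_le.mp hpz
    rw [mem_union, mem_biUnion]
    by_cases hpa : (q : ℝ) ^ a < p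
    · left
      rw [hA, mem_excPrimes, mem_Ioc]
      exact ⟨⟨(Nat.floor_lt (by positivity)).mpr hpa, hpY⟩, hpp, hpχ⟩
    · right
      rw [not_lt] at hpa
      -- here `K ≥ 2` (if `K = 1` then `z > q^a ≥ p ≥ z`)
      have hK2 : 2 ≤ K := by
        by_contra hK2
        have hK1' : K = 1 := by omega
        rw [hK1', Nat.cast_one, div_one] at hzK
        linarith
      -- the least `m ∈ [2, K]` with `q^{a/m} < p`
      set T : Finset ℕ := (Icc 2 K).filter fun m => (q : ℝ) ^ (a / m) < p with hT
      have hKT : K ∈ T := by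
        rw [hT, mem_filter, mem_Icc]
        exact ⟨⟨hK2, le_rfl⟩, hzK.trans_le hpz'⟩
      have hTne : T.Nonempty := ⟨K, hKT⟩
      set m : ℕ := T.min' hTne with hm
      have hmT : m ∈ T := min'_mem T hTne
      rw [hT, mem_filter, mem_Icc] at hmT
      obtain ⟨⟨hm2, hmK⟩, hmp⟩ := hmT
      refine ⟨m, mem_Icc.mpr ⟨hm2, hmK⟩, ?_⟩
      rw [hB, mem_excPrimes, mem_Ioc]
      refine ⟨⟨(Nat.floor_lt (by positivity)).mpr hmp, (Nat.le_floor_iff (by positivity)).mpr ?_⟩,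
        hpp, hpχ⟩
      rcases Nat.lt_or_ge 2 m with h3m | hm2'
      · -- `m ≥ 3`: `m - 1 ∉ T` by minimality
        have hnot : m - 1 ∉ T := by
          intro hmem
          have := min'_le T (m - 1) hmem
          omega
        rw [hT, mem_filter, mem_Icc, not_and, not_lt] at hnot
        have h := hnot ⟨by omega, by omega⟩
        have hcast : (((m - 1 : ℕ) : ℝ)) = (m : ℝ) - 1 := by
          rw [Nat.cast_sub (by omega)]; simp
        rw [hcast] at h
        exact h
      · -- `m = 2`: the range ends at `q^a`
        have hm_eq : m = 2 := le_antisymm hm2' hm2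
        rw [hm_eq]
        norm_num
        exact hpa
  -- sums over the cover
  have hf : ∀ p : ℕ, 0 ≤ (1 : ℝ) / p := fun p => by positivity
  have hunion : ∀ s t : Finset ℕ,
      ∑ p ∈ s ∪ t, (1 : ℝ) / p ≤ ∑ p ∈ s, (1 : ℝ) / p + ∑ p ∈ t, (1 : ℝ) / p := by
    intro s t
    have h1 := Finset.sum_union_inter (s₁ := s) (s₂ := t) (f := fun p : ℕ => (1 : ℝ) / p)
    have h2 : 0 ≤ ∑ p ∈ s ∩ t, (1 : ℝ) / p := Finset.sum_nonneg fun p _ => hf p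
    linarith
  have hbU : ∀ S : Finset ℕ,
      ∑ p ∈ S.biUnion B, (1 : ℝ) / p ≤ ∑ m ∈ S, ∑ p ∈ B m, (1 : ℝ) / p := by
    intro S
    induction S using Finset.induction_on with
    | empty => simp
    | insert i S hi ih =>
      rw [Finset.biUnion_insert, Finset.sum_insert hi]
      exact (hunion _ _).trans (by linarith)
  have hsum : ∑ p ∈ excPrimes χ (Icc ⌈z⌉₊ ⌊Y⌋₊), (1 : ℝ) / p ≤
      ∑ p ∈ A, (1 : ℝ) / p + ∑ m ∈ Icc 2 K, ∑ p ∈ B m, (1 : ℝ) / p :=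
    calc ∑ p ∈ excPrimes χ (Icc ⌈z⌉₊ ⌊Y⌋₊), (1 : ℝ) / p
        ≤ ∑ p ∈ A ∪ (Icc 2 K).biUnion B, (1 : ℝ) / p :=
          sum_le_sum_of_subset_of_nonneg hcover fun p _ _ => hf p
      _ ≤ ∑ p ∈ A, (1 : ℝ) / p + ∑ p ∈ (Icc 2 K).biUnion B, (1 : ℝ) / p := hunion _ _
      _ ≤ _ := by gcongr; exact hbU _
  -- piece `A`: (3.13), or nothing if `Y < q^a`
  have hAle : ∑ p ∈ A, (1 : ℝ) / p ≤ K₁' * (v / η * (Real.log Y / Real.log z)) := by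
    have hrhs : K₁' * (v / η * (Real.log Y / Real.log z)) = K₁' * (Real.log Y / Real.log q) / η := by
      rw [hlogz]
      field_simp
    rw [hrhs]
    rcases le_or_gt ((q : ℝ) ^ a) Y with hYa | hYa
    · have h := H₁ q χ hprim hquad η hη₁ hL Y (by rw [hexp₁]; exact hYa)
      rw [hexp₁] at h
      calc ∑ p ∈ A, (1 : ℝ) / p ≤ K₁ * (Real.log Y / Real.log q) / η := h
        _ ≤ K₁' * (Real.log Y / Real.log q) / η := by
            gcongr
            exact le_max_left _ _
    · have hAe : A = ∅ := by
        rw [hA, Finset.eq_empty_iff_forall_notMem]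
        intro p hp
        rw [mem_excPrimes, mem_Ioc] at hp
        have h1 : ⌊Y⌋₊ ≤ ⌊(q : ℝ) ^ a⌋₊ := Nat.floor_le_floor hYa.le
        omega
      rw [hAe, sum_empty]
      exact div_nonneg (mul_nonneg (le_max_right _ _) (div_nonneg hlogY.le hlogq.le)) hη0.le
  -- pieces `B m`: (3.14)
  have hBle : ∀ m ∈ Icc 2 K, ∑ p ∈ B m, (1 : ℝ) / p ≤ K₂' * K / η ^ ((1 : ℝ) / K) := by
    intro m hm
    rw [mem_Icc] at hm
    have hm0 : (0 : ℝ) < m := by exact_mod_cast (show 0 < m by omega)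
    have h := H₂ q χ hprim hquad η hη₂ hL m hm.1
    rw [hexp₂, hexp₃] at h
    have hpow : η ^ ((1 : ℝ) / K) ≤ η ^ ((1 : ℝ) / m) :=
      Real.rpow_le_rpow_of_exponent_le hη1 (by
        rw [div_le_div_iff_of_pos_left one_pos hK0 hm0]; exact_mod_cast hm.2)
    have hpowpos : 0 < η ^ ((1 : ℝ) / m) := Real.rpow_pos_of_pos hη0 _
    have hnum : K₂ * m ≤ K₂' * K :=
      (mul_le_mul_of_nonneg_right (le_max_left _ _) hm0.le).trans
        (mul_le_mul_of_nonneg_left (by exact_mod_cast hm.2) (le_max_right _ _))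
    have hnum0 : 0 ≤ K₂' * K := mul_nonneg (le_max_right _ _) hK0.le
    calc ∑ p ∈ B m, (1 : ℝ) / p ≤ K₂ * m / η ^ ((1 : ℝ) / m) := h
      _ ≤ K₂' * K / η ^ ((1 : ℝ) / m) := div_le_div_of_nonneg_right hnum hpowpos.le
      _ ≤ K₂' * K / η ^ ((1 : ℝ) / K) :=
          div_le_div_of_nonneg_left hnum0 (Real.rpow_pos_of_pos hη0 _) hpow
  have hBsum : ∑ m ∈ Icc 2 K, ∑ p ∈ B m, (1 : ℝ) / p ≤ 4 * K₂' * (1 / (v ^ 2 * η ^ (v / 2))) := by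
    rcases Nat.lt_or_ge K 2 with hK2 | hK2
    · -- `K = 1`: no pieces
      have : Icc 2 K = ∅ := Finset.Icc_eq_empty_of_lt hK2
      rw [this, sum_empty]
      exact mul_nonneg (mul_nonneg (by norm_num) (le_max_right _ _)) (by positivity)
    · -- `K ≥ 2`: `K ≤ a/v + 1 ≤ (3/2)/v`, `1/K ≥ v/2`
      have hav : 1 ≤ a / v := by
        have h : (⌊a / v⌋₊ : ℝ) ≤ a / v := Nat.floor_le (by positivity)
        have h1 : (1 : ℝ) ≤ ⌊a / v⌋₊ := by exact_mod_cast (show 1 ≤ ⌊a / v⌋₊ by omega)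
        linarith
      have hKle : (K : ℝ) ≤ a / v + 1 := by
        rw [hKdef]; push_cast; linarith [Nat.floor_le (show 0 ≤ a / v by positivity)]
      have hKle' : (K : ℝ) ≤ 2 / v := by
        have : a / v + 1 ≤ 2 * (a / v) := by linarith
        calc (K : ℝ) ≤ 2 * (a / v) := hKle.trans this
          _ = (2 * a) / v := by ring
          _ ≤ 2 / v := div_le_div_of_nonneg_right (by rw [ha]; norm_num) hv.le
      have hKinv : v / 2 ≤ 1 / K := by
        rw [div_le_div_iff₀ two_pos hK0, one_mul]
        have := (le_div_iff₀ hv).mp hKle'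
        linarith
      have hpow : η ^ (v / 2) ≤ η ^ ((1 : ℝ) / K) := Real.rpow_le_rpow_of_exponent_le hη1 hKinv
      have hpow0 : 0 < η ^ (v / 2) := Real.rpow_pos_of_pos hη0 _
      have hKsq : (K : ℝ) ^ 2 ≤ 4 / v ^ 2 := by
        calc (K : ℝ) ^ 2 ≤ (2 / v) ^ 2 := pow_le_pow_left₀ hK0.le hKle' 2
          _ = 4 / v ^ 2 := by rw [div_pow]; norm_num
      calc ∑ m ∈ Icc 2 K, ∑ p ∈ B m, (1 : ℝ) / p
          ≤ ∑ _m ∈ Icc 2 K, K₂' * K / η ^ ((1 : ℝ) / K) := sum_le_sum hBle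
        _ = ((K + 1 - 2 : ℕ) : ℝ) * (K₂' * K / η ^ ((1 : ℝ) / K)) := by
            rw [sum_const, Nat.card_Icc, nsmul_eq_mul]
        _ ≤ (K : ℝ) * (K₂' * K / η ^ ((1 : ℝ) / K)) := by
            refine mul_le_mul_of_nonneg_right ?_ (by positivity)
            exact_mod_cast (show K + 1 - 2 ≤ K by omega)
        _ = K₂' * ((K : ℝ) ^ 2 / η ^ ((1 : ℝ) / K)) := by ring
        _ ≤ K₂' * ((4 / v ^ 2) / η ^ (v / 2)) := by
            refine mul_le_mul_of_nonneg_left ?_ (le_max_right _ _)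
            calc (K : ℝ) ^ 2 / η ^ ((1 : ℝ) / K) ≤ (4 / v ^ 2) / η ^ ((1 : ℝ) / K) :=
                  div_le_div_of_nonneg_right hKsq (Real.rpow_pos_of_pos hη0 _).le
              _ ≤ (4 / v ^ 2) / η ^ (v / 2) :=
                  div_le_div_of_nonneg_left (by positivity) hpow0 hpow
        _ = 4 * K₂' * (1 / (v ^ 2 * η ^ (v / 2))) := by
            field_simp
  -- assemble
  have hB'0 : 0 ≤ 1 / (v ^ 2 * η ^ (v / 2)) := by positivity
  have hvt0 : 0 ≤ v / η * (Real.log Y / Real.log z) := by positivity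
  calc ∑ p ∈ excPrimes χ (Icc ⌈z⌉₊ ⌊Y⌋₊), (1 : ℝ) / p
      ≤ ∑ p ∈ A, (1 : ℝ) / p + ∑ m ∈ Icc 2 K, ∑ p ∈ B m, (1 : ℝ) / p := hsum
    _ ≤ K₁' * (v / η * (Real.log Y / Real.log z)) + 4 * K₂' * (1 / (v ^ 2 * η ^ (v / 2))) :=
        add_le_add hAle hBsum
    _ ≤ (max (4 * K₂') K₁' + 1) * (v / η * (Real.log Y / Real.log z)) +
          (max (4 * K₂') K₁' + 1) * (1 / (v ^ 2 * η ^ (v / 2))) := by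
        gcongr
        · linarith [le_max_right (4 * K₂') K₁']
        · linarith [le_max_left (4 * K₂') K₁']
    _ = (max (4 * K₂') K₁' + 1) *
          (1 / (v ^ 2 * η ^ (v / 2)) + v / η * (Real.log Y / Real.log z)) := by ring

end MatomakiMerikoski

/-! ### Lemma 2.2 -/

open MatomakiMerikoski

/-- **Matomäki–Merikoski 2023, Lemma 2.2** (as printed): "Let `χ` be a primitive quadratic
character modulo `q ≥ 2`. Assume that `L(s, χ)` has a real zero `β₀` such that
`β₀ = 1 − 1/(η log q)` for some `η ≥ 10`. Let `z = q^v` for some `v ∈ ℝ₊`. Then for any `Y > z`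
`∑_{z ≤ m ≤ Y, (m, P(z)) = 1} λ(m)/m ≪ (1/(v² η^{v/2}) + (v/η) · (log Y/log z) + 1/z) (log Y/log z)²`."
Here `λ = 1 ∗ χ` ((2.3); Mathlib's `DirichletCharacter.zetaMul`, real and `≥ 0` for quadratic
`χ`), `P(z) = ∏_{p < z} p`, so that `(m, P(z)) = 1` says that every prime factor of `m` is
`≥ z`; the implied constant is absolute (ineffective: Siegel's theorem enters through Lemma 4.1).
PROVED, following §4: `∑ ≤ Π − 1` with `Π = ∏_{z ≤ p ≤ Y} (1 − 1/p)⁻¹(1 − χ(p)/p)⁻¹`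
(`one_add_sum_rough_le_prod`; this absorbs the source's separate treatment of non-square-free
`m` via `λ ≤ τ`, (eq:f(n)/n_average)), then either the trivial bound `Π ≤ (C log Y/log z)²`
(`eulerFactor_le_sq`, Mertens `exists_window_prod_le`) — used when `η` is bounded or when the
bound to be proved exceeds `1`, as in the first sentence of the printed proof — or
`Π ≤ exp(∑_{z ≤ p ≤ Y} λ(p)/p + 8/z)` (`eulerFactor_le_exp`) with
`∑_{z ≤ p ≤ Y} λ(p)/p ≤ 2 ∑_{z ≤ p* ≤ Y} 1/p* ≪ 1/(v² η^{v/2}) + (v/η) log Y/log z` (Lemma 4.1,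
`exists_sum_excPrimes_window_le`) and `e^x − 1 ≤ 2x` for `0 ≤ x ≤ 1`.
[cite: MatomakiMerikoski2023, Lemma 2.2 (proof in §4)] -/
theorem MatomakiMerikoski2023_lemma22 :
    ∃ K : ℝ, 0 < K ∧ ∀ (q : ℕ) [NeZero q], 2 ≤ q → ∀ χ : DirichletCharacter ℂ q, χ.IsPrimitive →
      χ.IsQuadratic → ∀ η : ℝ, 10 ≤ η → χ.LFunction ((1 - 1 / (η * Real.log q) : ℝ) : ℂ) = 0 →
        ∀ v z Y : ℝ, 0 < v → z = (q : ℝ) ^ v → z < Y →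
          ∑ m ∈ (Icc ⌈z⌉₊ ⌊Y⌋₊).filter (fun m => ∀ p ∈ m.primeFactors, z ≤ ((p : ℕ) : ℝ)),
              (χ.zetaMul m).re / m ≤
            K * (1 / (v ^ 2 * η ^ (v / 2)) + v / η * (Real.log Y / Real.log z) + 1 / z) *
              (Real.log Y / Real.log z) ^ 2 := by
  classical
  obtain ⟨C_W, hC_W1, hW⟩ := exists_window_prod_le
  obtain ⟨C₁, η₀, hC₁, hTT⟩ := exists_sum_excPrimes_window_le
  set η₀' : ℝ := max η₀ 1 with hη₀'
  set C₂ : ℝ := max (2 * C₁) 8 with hC₂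
  have hC_W0 : 0 < C_W := by linarith
  have hη₀'1 : 1 ≤ η₀' := le_max_right _ _
  have hη₀'0 : 0 < η₀' := by linarith
  have hC₂8 : 8 ≤ C₂ := le_max_right _ _
  have hC₂0 : 0 < C₂ := by linarith
  set K : ℝ := max (C_W ^ 2 * η₀') (max (2 * C₂) (C_W ^ 2 * C₂)) with hK
  refine ⟨K, lt_max_of_lt_left (by positivity), ?_⟩
  intro q _ hq χ hprim hquad η hη10 hL v z Y hv hz hzY
  have hχ2 : χ ^ 2 = 1 := MulChar.isQuadratic_iff_sq_eq_one.mp hquad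
  -- basic quantities
  have hq1 : (1 : ℝ) < q := by exact_mod_cast hq
  have hz1 : 1 < z := by rw [hz]; exact Real.one_lt_rpow hq1 hv
  have hz0 : 0 < z := by linarith
  have hY1 : 1 < Y := by linarith
  have hlogz : 0 < Real.log z := Real.log_pos hz1
  have hη1 : 1 ≤ η := by linarith
  have hη0 : 0 < η := by linarith
  set t : ℝ := Real.log Y / Real.log z with ht
  have ht1 : 1 ≤ t := by
    rw [ht, le_div_iff₀ hlogz, one_mul]
    exact Real.log_le_log hz0 hzY.le
  have hpow0 : 0 < η ^ (v / 2) := Real.rpow_pos_of_pos hη0 _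
  set B' : ℝ := 1 / (v ^ 2 * η ^ (v / 2)) + v / η * t with hB'
  have hB'0 : 0 ≤ B' := by positivity
  set B : ℝ := B' + 1 / z with hB
  have hB0 : 0 ≤ B := by positivity
  set LHS : ℝ := ∑ m ∈ (Icc ⌈z⌉₊ ⌊Y⌋₊).filter (fun m => ∀ p ∈ m.primeFactors, z ≤ ((p : ℕ) : ℝ)),
    (χ.zetaMul m).re / m with hLHS
  -- how the proof ends: `LHS ≤ k · B t²` for some `k ≤ K`
  have hfin : ∀ k : ℝ, k ≤ K → LHS ≤ k * (B * t ^ 2) → LHS ≤ K * B * t ^ 2 := by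
    intro k hkK h
    calc LHS ≤ k * (B * t ^ 2) := h
      _ ≤ K * (B * t ^ 2) := mul_le_mul_of_nonneg_right hkK (by positivity)
      _ = K * B * t ^ 2 := by ring
  -- the window of primes and the Euler product `Π`
  set N : ℕ := ⌊Y⌋₊ with hN
  have hN1 : 1 ≤ N := Nat.le_floor (by exact_mod_cast hY1.le)
  set W : Finset ℕ := (N + 1).primesBelow.filter (fun p : ℕ => z ≤ (p : ℝ)) with hWdef
  have hWprime : ∀ p ∈ W, p.Prime := fun p hp =>
    Nat.prime_of_mem_primesBelow (mem_filter.mp hp).1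
  have hfac0 : ∀ p ∈ W, 0 ≤ (1 - (p : ℝ)⁻¹)⁻¹ * (1 - (χ p).re * (p : ℝ)⁻¹)⁻¹ := fun p hp =>
    zero_le_one.trans (one_le_eulerFactor χ (hWprime p hp))
  -- Step 1: `LHS ≤ Π − 1`
  have hstep1 : LHS ≤ (∏ p ∈ W, (1 - (p : ℝ)⁻¹)⁻¹ * (1 - (χ p).re * (p : ℝ)⁻¹)⁻¹) - 1 := by
    have h := one_add_sum_rough_le_prod χ hχ2 z hN1 (Nat.lt_succ_self N)
    have hsub : (Icc ⌈z⌉₊ N).filter (fun m => ∀ p ∈ m.primeFactors, z ≤ ((p : ℕ) : ℝ)) ⊆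
        (Ioc 1 N).filter (fun m => ∀ p ∈ m.primeFactors, z ≤ ((p : ℕ) : ℝ)) := by
      refine filter_subset_filter _ fun m hm => ?_
      rw [mem_Icc] at hm
      rw [mem_Ioc]
      have : 2 ≤ ⌈z⌉₊ := Nat.lt_ceil.mpr (by exact_mod_cast hz1)
      exact ⟨by omega, hm.2⟩
    have hmono : LHS ≤ ∑ m ∈ (Ioc 1 N).filter (fun m => ∀ p ∈ m.primeFactors, z ≤ ((p : ℕ) : ℝ)),
        (χ.zetaMul m).re / m :=
      sum_le_sum_of_subset_of_nonneg hsub fun m _ _ =>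
        div_nonneg (SmoothEulerProduct.zetaMul_re_nonneg χ hχ2 m) (Nat.cast_nonneg m)
    linarith
  -- Step 2: the trivial bound `Π ≤ (C_W t)²`
  have hP_triv : ∏ p ∈ W, (1 - (p : ℝ)⁻¹)⁻¹ * (1 - (χ p).re * (p : ℝ)⁻¹)⁻¹ ≤ (C_W * t) ^ 2 := by
    have h0 : 0 ≤ ∏ p ∈ W, (1 - (p : ℝ)⁻¹)⁻¹ := by
      refine prod_nonneg fun p hp => ?_
      have h2p : (2 : ℝ) ≤ p := by exact_mod_cast (hWprime p hp).two_le
      have : (p : ℝ)⁻¹ ≤ 1 / 2 := by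
        rw [inv_eq_one_div]; exact one_div_le_one_div_of_le two_pos h2p
      exact (inv_pos.mpr (by linarith)).le
    calc ∏ p ∈ W, (1 - (p : ℝ)⁻¹)⁻¹ * (1 - (χ p).re * (p : ℝ)⁻¹)⁻¹
        ≤ ∏ p ∈ W, ((1 - (p : ℝ)⁻¹)⁻¹) ^ 2 :=
          prod_le_prod hfac0 fun p hp => eulerFactor_le_sq χ (hWprime p hp)
      _ = (∏ p ∈ W, (1 - (p : ℝ)⁻¹)⁻¹) ^ 2 := prod_pow W 2 _
      _ ≤ (C_W * t) ^ 2 := pow_le_pow_left₀ h0 (hW z Y hz1 hzY.le) 2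
  -- Step 3: the fine bound `Π ≤ exp(S + 8/z)`, `S = ∑_{p ∈ W} λ(p)/p`
  have hS0 : 0 ≤ ∑ p ∈ W, (χ.zetaMul p).re / p :=
    sum_nonneg fun p _ => div_nonneg (SmoothEulerProduct.zetaMul_re_nonneg χ hχ2 p) (Nat.cast_nonneg p)
  have hP_fine : ∏ p ∈ W, (1 - (p : ℝ)⁻¹)⁻¹ * (1 - (χ p).re * (p : ℝ)⁻¹)⁻¹ ≤
      Real.exp (∑ p ∈ W, (χ.zetaMul p).re / p + 8 / z) := by
    calc ∏ p ∈ W, (1 - (p : ℝ)⁻¹)⁻¹ * (1 - (χ p).re * (p : ℝ)⁻¹)⁻¹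
        ≤ ∏ p ∈ W, Real.exp ((χ.zetaMul p).re / p + 4 / (p : ℝ) ^ 2) :=
          prod_le_prod hfac0 fun p hp => eulerFactor_le_exp χ hχ2 (hWprime p hp)
      _ = Real.exp (∑ p ∈ W, (χ.zetaMul p).re / p + ∑ p ∈ W, 4 / (p : ℝ) ^ 2) := by
          rw [← sum_add_distrib, Real.exp_sum]
      _ ≤ Real.exp (∑ p ∈ W, (χ.zetaMul p).re / p + 8 / z) :=
          Real.exp_le_exp.mpr (by linarith [sum_window_div_sq_le hz1 (N + 1)])
  -- Step 4: `S ≤ 2 ∑_{z ≤ p* ≤ Y} 1/p*`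
  have hS_le : ∑ p ∈ W, (χ.zetaMul p).re / p ≤
      2 * ∑ p ∈ SiegelZero.excPrimes χ (Icc ⌈z⌉₊ N), (1 : ℝ) / p := by
    have hpt : ∀ p ∈ W, (χ.zetaMul p).re / p ≤
        if χ (p : ZMod q) ≠ -1 then 2 * ((1 : ℝ) / p) else 0 := by
      intro p hp
      have hp' := hWprime p hp
      have hp0 : (0 : ℝ) < p := by exact_mod_cast hp'.pos
      rw [zetaMul_prime_re χ hχ2 hp']
      split_ifs with hχp
      · have hre : (χ p).re ≤ 1 :=
          (le_abs_self _).trans (SmoothEulerProduct.abs_apply_re_le_one χ p)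
        calc (1 + (χ p).re) / p ≤ 2 / p := div_le_div_of_nonneg_right (by linarith) hp0.le
          _ = 2 * ((1 : ℝ) / p) := by ring
      · push Not at hχp
        rw [hχp]
        norm_num
    calc ∑ p ∈ W, (χ.zetaMul p).re / p
        ≤ ∑ p ∈ W, (if χ ((p : ℕ) : ZMod q) ≠ -1 then 2 * ((1 : ℝ) / (p : ℕ)) else 0) :=
          sum_le_sum hpt
      _ = ∑ p ∈ W.filter (fun p : ℕ => χ (p : ZMod q) ≠ -1), 2 * ((1 : ℝ) / p) :=
          (sum_filter _ _).symm
      _ ≤ ∑ p ∈ SiegelZero.excPrimes χ (Icc ⌈z⌉₊ N), 2 * ((1 : ℝ) / p) := by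
          refine sum_le_sum_of_subset_of_nonneg ?_ fun p _ _ => by positivity
          intro p hp
          rw [mem_filter] at hp
          have hpW := mem_filter.mp hp.1
          rw [SiegelZero.mem_excPrimes, mem_Icc]
          refine ⟨⟨Nat.ceil_le.mpr hpW.2, ?_⟩, hWprime p hp.1, hp.2⟩
          exact Nat.lt_succ_iff.mp (Nat.mem_primesBelow.mp hpW.1).1
      _ = 2 * ∑ p ∈ SiegelZero.excPrimes χ (Icc ⌈z⌉₊ N), (1 : ℝ) / p := by rw [mul_sum]
  -- Step 5: assembly
  rcases lt_or_ge η η₀' with hηsmall | hηlarge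
  · -- bounded quality: the trivial bound, using `B ≥ 1/η₀'`
    have hBlow : 1 / η₀' ≤ B := by
      have h1 : 1 / η₀' ≤ 1 / η := one_div_le_one_div_of_le hη0 hηsmall.le
      have h2 : 1 / η ≤ B' := by
        rcases le_or_gt 1 v with hv1 | hv1
        · -- `v ≥ 1`: `(v/η) t ≥ 1/η`
          have : 1 / η ≤ v / η * t := by
            calc 1 / η = 1 / η * 1 := (mul_one _).symm
              _ ≤ v / η * t :=
                  mul_le_mul (div_le_div_of_nonneg_right hv1 hη0.le) ht1 zero_le_one
                    (by positivity)
          have : 0 ≤ 1 / (v ^ 2 * η ^ (v / 2)) := by positivity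
          linarith
        · -- `v < 1`: `1/(v² η^{v/2}) ≥ 1/η`
          have hv2 : v ^ 2 * η ^ (v / 2) ≤ η := by
            have hv21 : v ^ 2 ≤ 1 := by nlinarith
            have hpow : η ^ (v / 2) ≤ η ^ (1 : ℝ) :=
              Real.rpow_le_rpow_of_exponent_le hη1 (by linarith)
            rw [Real.rpow_one] at hpow
            calc v ^ 2 * η ^ (v / 2) ≤ 1 * η ^ (v / 2) :=
                  mul_le_mul_of_nonneg_right hv21 hpow0.le
              _ ≤ η := by rw [one_mul]; exact hpow
          have : 1 / η ≤ 1 / (v ^ 2 * η ^ (v / 2)) :=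
            one_div_le_one_div_of_le (by positivity) hv2
          have : 0 ≤ v / η * t := by positivity
          linarith
      have h3 : 0 ≤ 1 / z := by positivity
      linarith
    have h1B : 1 ≤ η₀' * B := by
      have := mul_le_mul_of_nonneg_left hBlow hη₀'0.le
      rwa [mul_one_div_cancel hη₀'0.ne'] at this
    refine hfin (C_W ^ 2 * η₀') (le_max_left _ _) ?_
    calc LHS ≤ (∏ p ∈ W, (1 - (p : ℝ)⁻¹)⁻¹ * (1 - (χ p).re * (p : ℝ)⁻¹)⁻¹) - 1 := hstep1
      _ ≤ (C_W * t) ^ 2 := by linarith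
      _ = C_W ^ 2 * t ^ 2 * 1 := by ring
      _ ≤ C_W ^ 2 * t ^ 2 * (η₀' * B) := mul_le_mul_of_nonneg_left h1B (by positivity)
      _ = C_W ^ 2 * η₀' * (B * t ^ 2) := by ring
  · -- large quality: Lemma 4.1 (Tao–Teräväinen)
    have hη₀ : η₀ ≤ η := (le_max_left _ _).trans hηlarge
    have hT := hTT q χ hprim hquad η hη₀ hL v hv Y (by rw [← hz]; exact hzY.le)
    rw [← hz] at hT
    have hT' : ∑ p ∈ SiegelZero.excPrimes χ (Icc ⌈z⌉₊ N), (1 : ℝ) / p ≤ C₁ * B' := hT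
    -- `x = S + 8/z ≤ C₂ B`
    have hx : ∑ p ∈ W, (χ.zetaMul p).re / p + 8 / z ≤ C₂ * B := by
      have h1 : ∑ p ∈ W, (χ.zetaMul p).re / p ≤ 2 * C₁ * B' := by
        have := mul_le_mul_of_nonneg_left hT' (by norm_num : (0 : ℝ) ≤ 2)
        linarith
      have h2 : 2 * C₁ * B' ≤ C₂ * B' := mul_le_mul_of_nonneg_right (le_max_left _ _) hB'0
      have h3 : 8 / z ≤ C₂ * (1 / z) := by
        rw [mul_one_div]
        exact div_le_div_of_nonneg_right hC₂8 hz0.le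
      calc ∑ p ∈ W, (χ.zetaMul p).re / p + 8 / z ≤ C₂ * B' + C₂ * (1 / z) := by linarith
        _ = C₂ * B := by rw [hB]; ring
    have hx0 : 0 ≤ ∑ p ∈ W, (χ.zetaMul p).re / p + 8 / z := by positivity
    rcases le_or_gt (∑ p ∈ W, (χ.zetaMul p).re / p + 8 / z) 1 with hx1 | hx1
    · -- `0 ≤ x ≤ 1`: `e^x − 1 ≤ 2x`
      refine hfin (2 * C₂) ((le_max_left _ _).trans (le_max_right _ _)) ?_
      have hexp : Real.exp (∑ p ∈ W, (χ.zetaMul p).re / p + 8 / z) - 1 ≤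
          2 * (∑ p ∈ W, (χ.zetaMul p).re / p + 8 / z) := by
        have := Real.abs_exp_sub_one_le (x := ∑ p ∈ W, (χ.zetaMul p).re / p + 8 / z)
          (by rw [abs_of_nonneg hx0]; exact hx1)
        rw [abs_of_nonneg hx0] at this
        exact (le_abs_self _).trans this
      calc LHS ≤ (∏ p ∈ W, (1 - (p : ℝ)⁻¹)⁻¹ * (1 - (χ p).re * (p : ℝ)⁻¹)⁻¹) - 1 := hstep1
        _ ≤ Real.exp (∑ p ∈ W, (χ.zetaMul p).re / p + 8 / z) - 1 := by linarith
        _ ≤ 2 * (∑ p ∈ W, (χ.zetaMul p).re / p + 8 / z) := hexp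
        _ ≤ 2 * (C₂ * B) := by linarith
        _ = 2 * C₂ * (B * 1) := by ring
        _ ≤ 2 * C₂ * (B * t ^ 2) :=
            mul_le_mul_of_nonneg_left (mul_le_mul_of_nonneg_left (one_le_pow₀ ht1) hB0)
              (by positivity)
    · -- `x > 1`: the trivial bound again
      refine hfin (C_W ^ 2 * C₂) ((le_max_right _ _).trans (le_max_right _ _)) ?_
      calc LHS ≤ (∏ p ∈ W, (1 - (p : ℝ)⁻¹)⁻¹ * (1 - (χ p).re * (p : ℝ)⁻¹)⁻¹) - 1 := hstep1
        _ ≤ (C_W * t) ^ 2 := by linarith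
        _ = C_W ^ 2 * (1 * t ^ 2) := by ring
        _ ≤ C_W ^ 2 * ((∑ p ∈ W, (χ.zetaMul p).re / p + 8 / z) * t ^ 2) :=
            mul_le_mul_of_nonneg_left (mul_le_mul_of_nonneg_right hx1.le (by positivity))
              (by positivity)
        _ ≤ C_W ^ 2 * (C₂ * B * t ^ 2) :=
            mul_le_mul_of_nonneg_left (mul_le_mul_of_nonneg_right hx (by positivity))
              (by positivity)
        _ = C_W ^ 2 * C₂ * (B * t ^ 2) := by ring

end Literature.Barriers.Parity
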